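import Mathlib
import Summits.Ventures.PercRepro2.Defs
import Summits.Ventures.PercRepro2.Graph
import Summits.Ventures.PercRepro2.Harris
import Summits.Ventures.PercRepro2.Events
import Summits.Ventures.PercRepro2.Independence
import Summits.Ventures.PercRepro2.Induced
import Summits.Ventures.PercRepro2.ForestCluster

/-!
# The forest part `G − t` of a graph, and the cluster mass of `G` through it
(blind cell PercRepro2, mine-c g9; proofs/MINEC-FEEDBACK.md §2 — first half of the
feedback-vertex gate; the theorem is in `GateFeedback.lean`)

`Ft ends t` = the edges not incident to `t`, `endsF ends t` = the edge family of `G − t` on that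
subtype, `res ends t ω` = the restriction of a configuration. For a vertex set `W ∌ t`:
* `clusterEvent_eq`: `{C(s) = W}` in `G` is `{C_F(s) = W}` in `G − t` together with «every edge
  between `W` and `t` is closed» (a walk from `s` avoiding `t` lives in `G − t`; a first arrival at
  `t` would use an open edge from `C_F(s) = W` to `t`);
* `prob_res_preimage`: marginalisation through `glue` — the probability of a pulled-back event of
  `G − t` is its probability under the restricted weights `pF`;
* `prob_clusterEvent_eq`: `P(C(s) = W) = P_F(C_F(s) = W) · ∏_{e ∈ E(W,t)} (1 − p_e)`.
-/

namespace Summit.Ventures.PercRepro2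

namespace GateFeedback

open scoped Classical

variable {V : Type*} {E : Type*} [Fintype E] [Fintype V]

/-! ## The forest part `G − t` -/

/-- The edges not incident to `t`. -/
def Ft (ends : E → Sym2 V) (t : V) : Set E := {e | t ∉ ends e}

/-- The edge family of `G − t` on the subtype of edges not at `t`. -/
def endsF (ends : E → Sym2 V) (t : V) : {e // e ∈ Ft ends t} → Sym2 V := fun e => ends e.1

/-- Restriction of a configuration to the edges not at `t`. -/
def res (ends : E → Sym2 V) (t : V) (ω : Config E) : Config {e // e ∈ Ft ends t} :=
  fun e => ω e.1

omit [Fintype E] [Fintype V] in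
/-- The open graph of `G − t` is a subgraph of the open graph of `G`. -/
lemma openGraph_res_le (ends : E → Sym2 V) (t : V) (ω : Config E) :
    openGraph (endsF ends t) (res ends t ω) ≤ openGraph ends ω := by
  intro x y hxy
  rw [openGraph_adj] at hxy ⊢
  obtain ⟨hne, e, he, hends⟩ := hxy
  exact ⟨hne, e.1, he, hends⟩

omit [Fintype E] [Fintype V] in
/-- A connection in `G − t` is a connection in `G`. -/
lemma conn_of_connF {ends : E → Sym2 V} {t : V} {ω : Config E} {x y : V}
    (h : Conn (endsF ends t) (res ends t ω) x y) : Conn ends ω x y :=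
  h.mono (openGraph_res_le ends t ω)

omit [Fintype E] [Fintype V] in
/-- An open walk of `G` avoiding `t` is an open walk of `G − t`. -/
lemma connF_of_walk {ends : E → Sym2 V} {t : V} {ω : Config E} {x y : V}
    (q : (openGraph ends ω).Walk x y) (ht : t ∉ q.support) :
    Conn (endsF ends t) (res ends t ω) x y := by
  refine ⟨q.transfer (openGraph (endsF ends t) (res ends t ω)) ?_⟩
  intro e he
  induction e using Sym2.ind with
  | h a b =>
    have hadj : (openGraph ends ω).Adj a b := q.adj_of_mem_edges he
    have ha : a ∈ q.support := q.fst_mem_support_of_mem_edges he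
    have hb : b ∈ q.support := q.snd_mem_support_of_mem_edges he
    rw [openGraph_adj] at hadj
    obtain ⟨hne, e', he', hends⟩ := hadj
    have hta : a ≠ t := fun h => ht (h ▸ ha)
    have htb : b ≠ t := fun h => ht (h ▸ hb)
    have hF : e' ∈ Ft ends t := by
      show t ∉ ends e'
      rw [hends, Sym2.mem_iff]
      rintro (h | h)
      · exact hta h.symm
      · exact htb h.symm
    rw [SimpleGraph.mem_edgeSet, openGraph_adj]
    exact ⟨hne, ⟨e', hF⟩, he', hends⟩

omit [Fintype E] [Fintype V] in
/-- If `s ↮ t`, the cluster of `s` in `G` is its cluster in `G − t`. -/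
lemma cluster_eq_clusterF {ends : E → Sym2 V} {t : V} {ω : Config E} {s : V}
    (hst : ¬ Conn ends ω s t) :
    cluster ends ω s = cluster (endsF ends t) (res ends t ω) s := by
  ext x
  simp only [mem_cluster]
  constructor
  · rintro ⟨q⟩
    refine connF_of_walk q fun ht => hst ⟨q.takeUntil t ht⟩
  · exact conn_of_connF

omit [Fintype E] [Fintype V] in
/-- The cluster event `{C(s) = W}` of `G`, for `t ∉ W`: the cluster event of `G − t` together with
«every edge between `W` and `t` is closed». -/
lemma clusterEvent_eq {ends : E → Sym2 V} {t : V} {s : V} {W : Finset V} (ht : t ∉ W)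
    (ω : Config E) :
    ω ∈ clusterEvent ends s (↑W : Set V) ↔
      res ends t ω ∈ clusterEvent (endsF ends t) s (↑W : Set V) ∧
        ∀ e, (∃ x ∈ W, ends e = s(x, t)) → ω e = false := by
  simp only [mem_clusterEvent]
  constructor
  · intro h
    have hst : ¬ Conn ends ω s t := by
      intro hc
      have : t ∈ cluster ends ω s := hc
      rw [h] at this
      exact ht (Finset.mem_coe.1 this)
    refine ⟨by rw [← cluster_eq_clusterF hst, h], ?_⟩
    rintro e ⟨x, hx, hex⟩
    by_contra hopen
    have hopen' : ω e = true := by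
      cases h' : ω e with
      | true => rfl
      | false => exact absurd h' hopen
    have hsx : Conn ends ω s x := by
      have : x ∈ cluster ends ω s := by rw [h]; exact Finset.mem_coe.2 hx
      exact this
    have hxt : x ≠ t := fun h' => ht (h' ▸ hx)
    have hadj : (openGraph ends ω).Adj x t := by
      rw [openGraph_adj]; exact ⟨hxt, e, hopen', hex⟩
    exact hst (hsx.trans hadj.reachable)
  · rintro ⟨hF, hclosed⟩
    have hst : ¬ Conn ends ω s t := by
      rintro ⟨q⟩
      -- the first arrival at `t` comes through an open edge `{y, t}` with `y ∈ W`
      have hsne : s ≠ t := by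
        rintro rfl
        have : s ∈ cluster (endsF ends s) (res ends s ω) s := mem_cluster_self _ _ _
        rw [hF] at this
        exact ht (Finset.mem_coe.1 this)
      have htq : t ∈ q.support := q.end_mem_support
      set q' := q.takeUntil t htq with hq'
      have hcount : q'.support.count t = 1 := q.count_support_takeUntil_eq_one htq
      -- reverse: a walk from `t` to `s` with `t` only at the start
      have hcount' : q'.reverse.support.count t = 1 := by
        rw [SimpleGraph.Walk.support_reverse, List.count_reverse]; exact hcount
      cases hq'' : q'.reverse with
      | nil => exact (hsne rfl).elim
      | cons hadj r =>
        rename_i y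
        have hr : t ∉ r.support := by
          rw [hq''] at hcount'
          rw [SimpleGraph.Walk.support_cons, List.count_cons_self] at hcount'
          intro hmem
          have := List.count_pos_iff.2 hmem
          omega
        have hsy : Conn (endsF ends t) (res ends t ω) s y :=
          connF_of_walk r.reverse (by rwa [SimpleGraph.Walk.support_reverse, List.mem_reverse])
        have hyW : y ∈ W := by
          have : y ∈ cluster (endsF ends t) (res ends t ω) s := hsy
          rw [hF] at this
          exact Finset.mem_coe.1 this
        rw [openGraph_adj] at hadj
        obtain ⟨_, e, he, hends⟩ := hadj
        have := hclosed e ⟨y, hyW, by rw [hends, Sym2.eq_swap]⟩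
        rw [he] at this
        exact Bool.true_eq_false.mp this |>.elim
    rw [cluster_eq_clusterF hst]
    exact hF

/-! ## The probability of a cluster event of `G` through the forest `G − t` -/

variable {R : Type*} [Field R] [LinearOrder R] [IsStrictOrderedRing R]

/-- The weights of `G − t`. -/
def pF (p : E → R) (ends : E → Sym2 V) (t : V) : {e // e ∈ Ft ends t} → R := fun e => p e.1

omit [Fintype E] [Fintype V] [IsStrictOrderedRing R] in
/-- Admissible weights restrict to admissible weights. -/
lemma IsProbVec.pF {p : E → R} (hp : IsProbVec p) (ends : E → Sym2 V) (t : V) :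
    IsProbVec (pF p ends t) :=
  ⟨fun e => hp.nonneg e.1, fun e => hp.le_one e.1⟩

/-- The edges between `W` and `t`. -/
noncomputable def Et (ends : E → Sym2 V) (t : V) (W : Finset V) : Finset E :=
  Finset.univ.filter fun e => ∃ x ∈ W, ends e = s(x, t)

omit [Fintype E] [Fintype V] [LinearOrder R] [IsStrictOrderedRing R] in
/-- `res (glue σ₁ σ₂) = σ₁`. -/
lemma res_glue (ends : E → Sym2 V) (t : V) (σ₁ : {e // e ∈ Ft ends t} → Bool)
    (σ₂ : {e // e ∉ Ft ends t} → Bool) : res ends t (glue (Ft ends t) σ₁ σ₂) = σ₁ := by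
  funext e
  exact glue_apply_of_mem (Ft ends t) σ₁ σ₂ e.2

omit [Fintype V] [LinearOrder R] [IsStrictOrderedRing R] in
/-- **Marginalisation**: the probability of an event of `G − t` pulled back to `G`. -/
lemma prob_res_preimage (p : E → R) (ends : E → Sym2 V) (t : V)
    (A : Set (Config {e // e ∈ Ft ends t})) :
    prob p (res ends t ⁻¹' A) = prob (pF p ends t) A := by
  rw [prob_eq_expect_indicator, expect_eq_sum_glue p _ (Ft ends t)]
  have h1 : ∀ σ₁ σ₂, (res ends t ⁻¹' A).indicator (1 : Config E → R) (glue (Ft ends t) σ₁ σ₂)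
      = A.indicator 1 σ₁ := by
    intro σ₁ σ₂
    simp only [Set.indicator, Set.mem_preimage, res_glue, Pi.one_apply]
  simp_rw [h1]
  rw [prob_eq_expect_indicator, expect]
  have h2 : ∀ σ₁ : Config {e // e ∈ Ft ends t}, ∑ σ₂ : Config {e // e ∉ Ft ends t},
      weight (fun i : {e // e ∈ Ft ends t} => p i.1) σ₁ *
        weight (fun i : {e // e ∉ Ft ends t} => p i.1) σ₂ * A.indicator 1 σ₁
      = weight (pF p ends t) σ₁ * A.indicator 1 σ₁ := by
    intro σ₁
    have : ∑ σ₂ : Config {e // e ∉ Ft ends t},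
        weight (fun i : {e // e ∉ Ft ends t} => p i.1) σ₂ = 1 := sum_weight _
    rw [← Finset.sum_mul, ← Finset.mul_sum, this, mul_one]
    rfl
  simp_rw [h2]

omit [Fintype E] [Fintype V] [LinearOrder R] [IsStrictOrderedRing R] in
/-- A pulled-back event depends only on the edges not at `t`. -/
lemma dependsOn_res_preimage (ends : E → Sym2 V) (t : V) (A : Set (Config {e // e ∈ Ft ends t})) :
    DependsOn (· ∈ res ends t ⁻¹' A) (Ft ends t) := by
  intro ω ω' h
  have : res ends t ω = res ends t ω' := funext fun e => h e.1 e.2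
  simp only [Set.mem_preimage, this]

omit [Fintype E] [Fintype V] [LinearOrder R] [IsStrictOrderedRing R] in
/-- A cylinder depends only on its edges. -/
lemma dependsOn_cylinder (F : Finset E) (σ : Config E) :
    DependsOn (· ∈ cylinder F σ) (↑F : Set E) := by
  intro ω ω' h
  simp only [mem_cylinder]
  exact propext (forall_congr' fun e => forall_congr' fun he => by rw [h e (Finset.mem_coe.2 he)])

omit [Fintype V] [LinearOrder R] [IsStrictOrderedRing R] in
/-- **The cluster mass of `G` through the forest**: for `t ∉ W`,
`P(C(s) = W) = P_F(C_F(s) = W) · ∏_{e ∈ E(W,t)} (1 − p_e)`. -/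
theorem prob_clusterEvent_eq (p : E → R) (ends : E → Sym2 V) (s t : V) {W : Finset V}
    (ht : t ∉ W) :
    prob p (clusterEvent ends s (↑W : Set V)) =
      prob (pF p ends t) (clusterEvent (endsF ends t) s (↑W : Set V)) *
        ∏ e ∈ Et ends t W, (1 - p e) := by
  have hset : clusterEvent ends s (↑W : Set V) =
      (res ends t ⁻¹' clusterEvent (endsF ends t) s (↑W : Set V)) ∩
        cylinder (Et ends t W) (fun _ => false) := by
    ext ω
    rw [clusterEvent_eq ht ω]
    simp only [Set.mem_inter_iff, Set.mem_preimage, mem_cylinder, Et, Finset.mem_filter,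
      Finset.mem_univ, true_and]
  rw [hset, prob_inter_eq_mul_of_dependsOn p (F₁ := Ft ends t) (F₂ := ↑(Et ends t W)) ?_
    (dependsOn_res_preimage ends t _) (dependsOn_cylinder _ _), prob_res_preimage,
    prob_cylinder]
  · simp only [edgeFactor_false]
  · rw [Set.disjoint_left]
    rintro e he hee
    simp only [Finset.coe_filter, Et, Finset.mem_univ, true_and, Set.mem_setOf_eq] at hee
    obtain ⟨x, _, hex⟩ := hee
    exact he (by rw [hex]; exact Sym2.mem_mk_right x t)

/-! ## The edges between `W` and `t`: modularity of the closed-edge factor -/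

omit [Fintype V] [LinearOrder R] [IsStrictOrderedRing R] in
/-- The edges between `W₁ ∪ W₂` and `t`. -/
lemma Et_union (ends : E → Sym2 V) (t : V) (W₁ W₂ : Finset V) :
    Et ends t (W₁ ∪ W₂) = Et ends t W₁ ∪ Et ends t W₂ := by
  ext e
  simp only [Et, Finset.mem_filter, Finset.mem_univ, true_and, Finset.mem_union]
  constructor
  · rintro ⟨x, hx, hex⟩
    rcases hx with hx | hx
    · exact Or.inl ⟨x, hx, hex⟩
    · exact Or.inr ⟨x, hx, hex⟩
  · rintro (⟨x, hx, hex⟩ | ⟨x, hx, hex⟩)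
    · exact ⟨x, Or.inl hx, hex⟩
    · exact ⟨x, Or.inr hx, hex⟩

omit [Fintype V] [LinearOrder R] [IsStrictOrderedRing R] in
/-- The edges between `W₁ ∩ W₂` and `t`. -/
lemma Et_inter (ends : E → Sym2 V) (t : V) (W₁ W₂ : Finset V) :
    Et ends t (W₁ ∩ W₂) = Et ends t W₁ ∩ Et ends t W₂ := by
  ext e
  simp only [Et, Finset.mem_filter, Finset.mem_univ, true_and, Finset.mem_inter]
  constructor
  · rintro ⟨x, ⟨hx1, hx2⟩, hex⟩
    exact ⟨⟨x, hx1, hex⟩, ⟨x, hx2, hex⟩⟩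
  · rintro ⟨⟨x, hx, hex⟩, ⟨y, hy, hey⟩⟩
    have hxy : x = y := by
      rw [hex] at hey
      rcases Sym2.eq_iff.1 hey with ⟨h, _⟩ | ⟨h1, h2⟩
      · exact h
      · exact h1.trans h2
    subst hxy
    exact ⟨x, ⟨hx, hy⟩, hex⟩

/-- The closed-edge factor of the edges between `W` and `t`. -/
noncomputable def tau (p : E → R) (ends : E → Sym2 V) (t : V) (W : Finset V) : R :=
  ∏ e ∈ Et ends t W, (1 - p e)

omit [Fintype V] [LinearOrder R] [IsStrictOrderedRing R] in
/-- `tau` is modular. -/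
lemma tau_mul (p : E → R) (ends : E → Sym2 V) (t : V) (W₁ W₂ : Finset V) :
    tau p ends t W₁ * tau p ends t W₂ = tau p ends t (W₁ ∩ W₂) * tau p ends t (W₁ ∪ W₂) := by
  unfold tau
  rw [Et_inter, Et_union, mul_comm (∏ e ∈ Et ends t W₁ ∩ Et ends t W₂, (1 - p e)),
    Finset.prod_union_inter]

omit [Fintype V] in
/-- `tau` is nonnegative for admissible weights. -/
lemma tau_nonneg {p : E → R} (hp : IsProbVec p) (ends : E → Sym2 V) (t : V) (W : Finset V) :
    0 ≤ tau p ends t W :=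
  Finset.prod_nonneg fun e _ => sub_nonneg.2 (hp.le_one e)

end GateFeedback

end Summit.Ventures.PercRepro2
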